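import Literature.NumberTheory.Li1992.RallisInnerProductThetaLift
import Literature.NumberTheory.Automorphic.AdelicPiSchwartzBruhatToLp
import Mathlib.Analysis.InnerProductSpace.Basic
import Mathlib.MeasureTheory.Function.L2Space
import HarnessLib

/-!
# [Li1992, p. 178] ∕ [Weil1964, Chap. I n° 11, 13] — POLARISED UNITARITY of the Weil representation on `𝒮(𝔸_Fⁿ)`: an
# `L²`-norm-preserving linear operator preserves the pairing `⟨Φ₁, Φ₂⟩ = ∫ Φ₁ \overline{Φ₂} dν`

J.-S. Li, J. reine angew. Math. **428** (1992), p. 178: «the realization of `ω` on `L²(X)` … The associated space of smooth vectors is the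
Bruhat–Schwartz space `S(X(A))`» — `ω` is UNITARY, so `⟨ω(h)φ₁, ω(h)φ₂⟩ = ⟨φ₁, φ₂⟩`; A. Weil, Acta Math. 111 (1964), Chap. I n° 11, n° 13 (the
metaplectic operators are unitary on `L²(X)`).  The tree's letters carry unitarity in the NORM form
`hiso : ∫⁻ ‖(ω(p)Φ)‖ₑ² dν_X = ∫⁻ ‖Φ‖ₑ² dν_X` (★ `Li1992.RallisInnerProductFormulaUnitaryDualPair[RankOne][Cont]`, discharged by ★
`UnitaryDualPair.lintegral_enorm_sq_pairRep_eq`).  THIS FILE polarises it (kernel only):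

* `schwartzPairing_eq_inner_piSchwartzBruhatToLp` — `⟨Φ₁, Φ₂⟩_ν = ⟪[Φ₂], [Φ₁]⟫_{L²(ν)}` for the class map ★ `piSchwartzBruhatToLp`;
* **`schwartzPairing_map_map_of_lintegral_eq`** — for a `ℂ`-LINEAR `A : 𝒮(𝔸_Fⁿ) → 𝒮(𝔸_Fⁿ)` with `∫⁻ ‖AΦ‖ₑ² = ∫⁻ ‖Φ‖ₑ²` for all `Φ`:
  `⟨AΦ₁, AΦ₂⟩_ν = ⟨Φ₁, Φ₂⟩_ν` (Mathlib's polarization identity `inner_eq_sum_norm_sq_div_four` in `L²(ν)`);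
* **`UnitaryDualPair.schwartzPairing_pairRep_pairRep`** — for the Weil representation `ω = ω_ψ ∘ s_pair` of the tree's unitary dual pair under the
  letter's `hiso`: `⟨ω(p)Φ₁, ω(p)Φ₂⟩_{ν_X} = ⟨Φ₁, Φ₂⟩_{ν_X}`, and the one-sided form `⟨ω(p)Φ₁, Φ₂⟩ = ⟨Φ₁, ω(p⁻¹)Φ₂⟩` — the «absorption of `x₁, x₂`
  into the test functions» used by the E-2 child line (`Cruxes/H413/Lines/F0_E2SiegelWeilWeilRange.lean`, R0) and by SW4.

KERNEL only: theorems, no definition, no `sorry`.  Cell hodgecm-mathlib, FLOOR 0, engine E-2 (S6), crux item H413 (`--supports stmt-HodgeConjecture-24833`).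
HC_CM is proved only modulo the printed citations until rung 0 closes.

## References
* [Li1992] J.-S. Li, J. reine angew. Math. 428 (1992) 177–217 — p. 178.
* [Weil1964] A. Weil, Acta Math. 111 (1964) 143–211 — Chap. I n° 11, n° 13.
-/

set_option autoImplicit false

noncomputable section

open _root_.MeasureTheory NumberField
open scoped ComplexConjugate InnerProductSpace ENNReal
open Literature.NumberTheory.Automorphic

namespace Literature.NumberTheory.Li1992

section Generic

variable (F : Type) [Field F] [NumberField F] (ι : Type) [Fintype ι]
  [MeasurableSpace (AdeleRing (𝓞 F) F)] [BorelSpace (AdeleRing (𝓞 F) F)]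
  (νX : Measure (ι → AdeleRing (𝓞 F) F)) [νX.IsAddHaarMeasure]

/-- **`⟨Φ₁, Φ₂⟩_ν = ⟪[Φ₂], [Φ₁]⟫_{L²(ν)}`** for the class map `[·] = piSchwartzBruhatToLp` (Mathlib's inner product is conjugate-linear in the
first slot; `[Φ] = Φ` a.e.). [cite: Weil1964, Chap. I n° 11] -/
theorem schwartzPairing_eq_inner_piSchwartzBruhatToLp (Φ₁ Φ₂ : piSchwartzBruhat F ι) :
    schwartzPairing F ι νX Φ₁ Φ₂ =
      ⟪(piSchwartzBruhatToLp F ι νX Φ₂ : Lp ℂ 2 νX), (piSchwartzBruhatToLp F ι νX Φ₁ : Lp ℂ 2 νX)⟫_ℂ := by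
  rw [schwartzPairing_apply, MeasureTheory.L2.inner_def]
  refine integral_congr_ae ?_
  filter_upwards [coeFn_piSchwartzBruhatToLp νX Φ₁, coeFn_piSchwartzBruhatToLp νX Φ₂] with x h₁ h₂
  rw [h₁, h₂, RCLike.inner_apply, mul_comm]

/-- **POLARISATION: an `L²`-norm-preserving `ℂ`-linear operator on `𝒮(𝔸_Fⁿ)` preserves the pairing** — if
`∫⁻ ‖AΦ‖ₑ² dν = ∫⁻ ‖Φ‖ₑ² dν` for all `Φ`, then `⟨AΦ₁, AΦ₂⟩_ν = ⟨Φ₁, Φ₂⟩_ν` (the four norms in the polarization identity for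
`([AΦ₂], [AΦ₁])` are those for `([Φ₂], [Φ₁])`, by linearity of `[·] ∘ A`). [cite: Weil1964, Chap. I n° 13] [cite: Li1992, p. 178] -/
theorem schwartzPairing_map_map_of_lintegral_eq (A : piSchwartzBruhat F ι →ₗ[ℂ] piSchwartzBruhat F ι)
    (hA : ∀ Φ : piSchwartzBruhat F ι,
      ∫⁻ x, ‖((A Φ : piSchwartzBruhat F ι) : (ι → AdeleRing (𝓞 F) F) → ℂ) x‖ₑ ^ 2 ∂νX =
        ∫⁻ x, ‖(Φ : (ι → AdeleRing (𝓞 F) F) → ℂ) x‖ₑ ^ 2 ∂νX)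
    (Φ₁ Φ₂ : piSchwartzBruhat F ι) :
    schwartzPairing F ι νX (A Φ₁) (A Φ₂) = schwartzPairing F ι νX Φ₁ Φ₂ := by
  -- the class map composed with `A`, and the norm identity `‖[AΦ]‖ = ‖[Φ]‖`
  set i : piSchwartzBruhat F ι →ₗ[ℂ] Lp ℂ 2 νX := piSchwartzBruhatToLp F ι νX with hi
  have hn : ∀ Φ : piSchwartzBruhat F ι, ‖i (A Φ)‖ = ‖i Φ‖ := fun Φ =>
    norm_piSchwartzBruhatToLp_eq_of_lintegral_eq νX (hA Φ)
  rw [schwartzPairing_eq_inner_piSchwartzBruhatToLp F ι νX, schwartzPairing_eq_inner_piSchwartzBruhatToLp F ι νX, ← hi,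
    inner_eq_sum_norm_sq_div_four, inner_eq_sum_norm_sq_div_four]
  -- the four norms agree
  have h1 : ‖i (A Φ₂) + i (A Φ₁)‖ = ‖i Φ₂ + i Φ₁‖ := by rw [← map_add, ← map_add, hn, map_add]
  have h2 : ‖i (A Φ₂) - i (A Φ₁)‖ = ‖i Φ₂ - i Φ₁‖ := by rw [← map_sub, ← map_sub, hn, map_sub]
  have h3 : ‖i (A Φ₂) - (RCLike.I : ℂ) • i (A Φ₁)‖ = ‖i Φ₂ - (RCLike.I : ℂ) • i Φ₁‖ := by
    rw [← map_smul, ← map_sub, ← map_smul, ← map_sub, hn, map_sub, map_smul]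
  have h4 : ‖i (A Φ₂) + (RCLike.I : ℂ) • i (A Φ₁)‖ = ‖i Φ₂ + (RCLike.I : ℂ) • i Φ₁‖ := by
    rw [← map_smul, ← map_add, ← map_smul, ← map_add, hn, map_add, map_smul]
  rw [h1, h2, h3, h4]

end Generic

end Literature.NumberTheory.Li1992

/-! ## The Weil representation of the unitary dual pair: `⟨ω(p)Φ₁, ω(p)Φ₂⟩ = ⟨Φ₁, Φ₂⟩` under `hiso` -/

namespace Literature.NumberTheory.GelbartRogawski1991.UnitaryDualPair

open Literature.NumberTheory.Li1992 Literature.NumberTheory.Weil1964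

variable (F E : Type) [Field F] [NumberField F] [Field E] [NumberField E] [Algebra F E]
  (c : E ≃ₐ[F] E) (N M : ℕ) {n : ℕ} (e : Fin N × Fin M ≃ Fin n)
  (JV : Matrix (Fin N) (Fin N) E) (JW : Matrix (Fin M) (Fin M) E)
  {TV : Matrix (Fin N) (Fin N) F} {TW : Matrix (Fin M) (Fin M) F}
  (s : UnitaryGroup.adelicPair F E c N M JV JW →* adelicMpCont F (Fin n) (adelicGram F e TV TW))
  [MeasurableSpace (AdeleRing (𝓞 F) F)] [BorelSpace (AdeleRing (𝓞 F) F)]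
  (νX : Measure (Fin n → AdeleRing (𝓞 F) F)) [νX.IsAddHaarMeasure]
  (hiso : ∀ (p : UnitaryGroup.adelic F E c N JV × UnitaryGroup.adelic F E c M JW) (Φ : piSchwartzBruhat F (Fin n)),
    ∫⁻ x, ‖(pairRep F E c N M e JV JW s p Φ : (Fin n → AdeleRing (𝓞 F) F) → ℂ) x‖ₑ ^ 2 ∂νX =
      ∫⁻ x, ‖(Φ : (Fin n → AdeleRing (𝓞 F) F) → ℂ) x‖ₑ ^ 2 ∂νX)

include hiso in
/-- **`⟨ω(p)Φ₁, ω(p)Φ₂⟩_{ν_X} = ⟨Φ₁, Φ₂⟩_{ν_X}`** for the Weil representation `ω = ω_ψ ∘ s_pair` of `U(J_V)(𝔸) × U(J_W)(𝔸)` on `𝒮(𝔸_Fⁿ)`, from the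
letter's NORM unitarity `hiso` by polarisation. [cite: Li1992, p. 178] [cite: Weil1964, Chap. I n° 13] -/
theorem schwartzPairing_pairRep_pairRep (p : UnitaryGroup.adelic F E c N JV × UnitaryGroup.adelic F E c M JW)
    (Φ₁ Φ₂ : piSchwartzBruhat F (Fin n)) :
    schwartzPairing F (Fin n) νX (pairRep F E c N M e JV JW s p Φ₁) (pairRep F E c N M e JV JW s p Φ₂) =
      schwartzPairing F (Fin n) νX Φ₁ Φ₂ :=
  schwartzPairing_map_map_of_lintegral_eq F (Fin n) νX (pairRep F E c N M e JV JW s p) (hiso p) Φ₁ Φ₂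

include hiso in
/-- **one-sided form**: `⟨ω(p)Φ₁, Φ₂⟩_{ν_X} = ⟨Φ₁, ω(p⁻¹)Φ₂⟩_{ν_X}` (apply the two-sided identity at `p⁻¹` to `(ω(p)Φ₁, Φ₂)`; `ω(p⁻¹)ω(p) = 1`).
[cite: Li1992, p. 178] [cite: Weil1964, Chap. I n° 13] -/
theorem schwartzPairing_pairRep_left (p : UnitaryGroup.adelic F E c N JV × UnitaryGroup.adelic F E c M JW)
    (Φ₁ Φ₂ : piSchwartzBruhat F (Fin n)) :
    schwartzPairing F (Fin n) νX (pairRep F E c N M e JV JW s p Φ₁) Φ₂ =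
      schwartzPairing F (Fin n) νX Φ₁ (pairRep F E c N M e JV JW s p⁻¹ Φ₂) := by
  have h := schwartzPairing_pairRep_pairRep F E c N M e JV JW s νX hiso p⁻¹ (pairRep F E c N M e JV JW s p Φ₁) Φ₂
  rw [← Module.End.mul_apply, ← map_mul, inv_mul_cancel, map_one, Module.End.one_apply] at h
  exact h.symm

include hiso in
/-- **the absorbed orbit coefficient** (R0 of the E-2 child line): `⟨ω(x₂ γ x₁⁻¹)Φ₁, Φ₂⟩ = ⟨ω(γ)(ω(x₁⁻¹)Φ₁), ω(x₂⁻¹)Φ₂⟩` for all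
`γ x₁ x₂` in the pair group. [cite: Li1992, (24)–(25) p. 184] -/
theorem schwartzPairing_pairRep_conj (γ x₁ x₂ : UnitaryGroup.adelic F E c N JV × UnitaryGroup.adelic F E c M JW)
    (Φ₁ Φ₂ : piSchwartzBruhat F (Fin n)) :
    schwartzPairing F (Fin n) νX (pairRep F E c N M e JV JW s (x₂ * γ * x₁⁻¹) Φ₁) Φ₂ =
      schwartzPairing F (Fin n) νX (pairRep F E c N M e JV JW s γ (pairRep F E c N M e JV JW s x₁⁻¹ Φ₁))
        (pairRep F E c N M e JV JW s x₂⁻¹ Φ₂) := by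
  rw [← schwartzPairing_pairRep_pairRep F E c N M e JV JW s νX hiso x₂⁻¹ (pairRep F E c N M e JV JW s (x₂ * γ * x₁⁻¹) Φ₁) Φ₂,
    ← Module.End.mul_apply, ← map_mul, ← Module.End.mul_apply (pairRep F E c N M e JV JW s γ), ← map_mul]
  congr 2
  group

end Literature.NumberTheory.GelbartRogawski1991.UnitaryDualPair

end
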